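import Mathlib
import HarnessLib
import Literature.MathematicalPhysics.QuantumLattice.HubbardSectorFieldSubstitution
import Literature.MathematicalPhysics.QuantumLattice.HubbardSpaceTimeCharacters

/-!
# Route `KLProgramme` — engine support, route (L2) for the sector-multiplier overlap kernel (BGM (2.71a)): the row and column sums
# of `‖(E′S)((y,ℓ′),(x,ℓ))‖` at fixed labels ARE `(βL²)⁻¹ ×` the `ℓ¹` norm of a space-time character sum of the two-multiplier symbol

Cell `gate-hubbard-kl`, seat p4 (C5a lead), g6; HOME/prover-p4/FRAME-L22-NOTE.md §2.  The overlap kernel of the representation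
theorem (`hubbardSectorKernelNorm_effAction_le`, hypotheses `hrow′/hcol′`) is
`(E′S)((y,(ω′,σ,c)),(x,(ω,σ,c))) = Σ_k F′_{ω′}(k) e^{-is_c k·y} (βL²)⁻¹ F_ω(k) conj(e^{-is_c k·x})` (`sectorAnalysis_mul_sectorSub_apply`).
By the character dictionary of `HubbardSpaceTimeCharacters` (`conj_hubbardPlaneWave_mul_conj_hubbardPlaneWave`: the phase of a contraction is
a product-torus character times a unimodular, momentum-independent factor) its norm is `(βL²)⁻¹ ‖S(±(x − y))‖` with the character sum
`S(z) = Σ_q χ_{q₁}(z₁) χ_{q₂}(z₂) • Φ̃(q)`, `Φ̃(q) = F′_{ω′}(k(q)) F_ω(k(q))` the two-multiplier symbol reindexed by the time dual torus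
(`norm_overlapKernel_eq_charSum`), so BOTH the row sum (over `x`) and the column sum (over `y`) equal `(βL²)⁻¹ Σ_z ‖S(z)‖`
(**`rowSum_overlapKernel_eq`**, **`colSum_overlapKernel_eq`**) — the quantity bounded by the additive `ℓ²` route
(`KLProgrammeKLRegimeTorusL1SecondDifferences.sum_norm_charSum_le_of_second_differences`).  With p4's reduction
`rowSum_/colSum_sectorAnalysis_mul_sectorSub_le` (`…FrameSectorOverlap`, overlap counts `≤ 9`, `≤ 9·2^Δ`) this is `hrow′/hcol′`.
Everything is proved; no definitions, no named facts. [cite: BenfattoGiulianiMastropietro2006, §2.7 (2.71)–(2.71a)]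
-/

noncomputable section

namespace Summit.HubbardSuperconductivity.HubbardSuperconductivity.Theorems.TorusFourierL2

set_option linter.dupNamespace false -- summit = problem name (single-conjunct summit), D-0017

open Finset Complex Literature.Probability.LatticeModels Literature.MathematicalPhysics.QuantumLattice
open scoped Real ComplexConjugate

variable {L M : ℕ} [NeZero L] [NeZero M] {N N' : ℕ}

omit [NeZero L] [NeZero M] in
/-- `e^{-i·(+1)k·x}` and `e^{-i·(-1)k·x}` are complex conjugates: `pw 0 k x = conj (pw 1 k x)`. [folklore] -/
theorem hubbardPlaneWave_zero_eq_conj_one (β : ℝ) (k : FreqMomentum L M) (x : SpaceTimeIdx L M) :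
    hubbardPlaneWave L M β 0 k x = conj (hubbardPlaneWave L M β 1 k x) := by
  simp only [hubbardPlaneWave, chargeSign, if_true, show (1 : Fin 2) ≠ 0 by decide, if_false, ← Complex.exp_conj, map_mul,
    map_neg, Complex.conj_ofReal, Complex.conj_I]
  congr 1
  push_cast
  ring

omit [NeZero L] [NeZero M] in
/-- The overlap phase for charge `0`: `pw 0 k y · conj(pw 0 k x) = conj(pw 0 k x) · conj(pw 1 k y)`. [folklore] -/
theorem overlapPhase_zero (β : ℝ) (k : FreqMomentum L M) (x y : SpaceTimeIdx L M) :
    hubbardPlaneWave L M β 0 k y * conj (hubbardPlaneWave L M β 0 k x) =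
      conj (hubbardPlaneWave L M β 0 k x) * conj (hubbardPlaneWave L M β 1 k y) := by
  rw [hubbardPlaneWave_zero_eq_conj_one β k y]; ring

omit [NeZero L] [NeZero M] in
/-- The overlap phase for charge `1`: `pw 1 k y · conj(pw 1 k x) = conj(pw 0 k y) · conj(pw 1 k x)`. [folklore] -/
theorem overlapPhase_one (β : ℝ) (k : FreqMomentum L M) (x y : SpaceTimeIdx L M) :
    hubbardPlaneWave L M β 1 k y * conj (hubbardPlaneWave L M β 1 k x) =
      conj (hubbardPlaneWave L M β 0 k y) * conj (hubbardPlaneWave L M β 1 k x) := by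
  rw [hubbardPlaneWave_zero_eq_conj_one β k y, Complex.conj_conj]

omit [NeZero M] in
/-- **The overlap kernel at fixed labels is `(βL²)⁻¹` times a contraction sum of the two-multiplier symbol**:
`(E′S)((y,(ω′,σ,c)),(x,(ω,σ,c))) = (βL²)⁻¹ Σ_k [pw c k y · conj(pw c k x)] · F′_{ω′}(k) F_ω(k)`. [cite: BenfattoGiulianiMastropietro2006, §2.7 (2.71)] -/
theorem overlapKernel_eq (β : ℝ) (F' : Fin N' → FreqMomentum L M → ℂ) (F : Fin N → FreqMomentum L M → ℂ)
    (ω' : Fin N') (ω : Fin N) (σ c : Fin 2) (y x : SpaceTimeIdx L M) :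
    (sectorAnalysisMatrix L M β F' * sectorSubMatrix L M β F) (y, ((ω', σ), c)) (x, ((ω, σ), c)) =
      ((1 / (β * (L : ℝ) ^ 2) : ℝ) : ℂ) *
        ∑ k : FreqMomentum L M, hubbardPlaneWave L M β c k y * conj (hubbardPlaneWave L M β c k x) * (F' ω' k * F ω k) := by
  rw [sectorAnalysis_mul_sectorSub_apply, if_pos ⟨rfl, rfl⟩, Finset.mul_sum]
  refine Finset.sum_congr rfl fun k _ => ?_
  simp only
  ring

/-- **The norm of the overlap kernel is `(βL²)⁻¹` times the norm of a product-torus character sum** of the two-multiplier symbol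
`Φ̃(q) = F′_{ω′}(k(q)) F_ω(k(q))` at the displacement `x − y` (charge `0`) resp. `y − x` (charge `1`), `β > 0`.
[cite: BenfattoGiulianiMastropietro2006, §2.7 (2.71) and footnote 1] -/
theorem norm_overlapKernel_eq_charSum {β : ℝ} (hβ : 0 < β) (F' : Fin N' → FreqMomentum L M → ℂ)
    (F : Fin N → FreqMomentum L M → ℂ) (ω' : Fin N') (ω : Fin N) (σ c : Fin 2) (y x : SpaceTimeIdx L M) :
    ‖(sectorAnalysisMatrix L M β F' * sectorSubMatrix L M β F) (y, ((ω', σ), c)) (x, ((ω, σ), c))‖ =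
      1 / (β * (L : ℝ) ^ 2) *
        ‖∑ q : TorusSite 1 (2 * M) × TorusSite 2 L,
          (torusChar q.1 (fun _ : Fin 1 => (((if c = 0 then x else y).1 : ℕ) : ZMod (2 * M)) -
              (((if c = 0 then y else x).1 : ℕ) : ZMod (2 * M))) *
            torusChar q.2 ((if c = 0 then x else y).2 - (if c = 0 then y else x).2)) •
          (F' ω' (⟨(q.1 0).val, ZMod.val_lt (q.1 0)⟩, q.2) * F ω (⟨(q.1 0).val, ZMod.val_lt (q.1 0)⟩, q.2))‖ := by
  have hL : (0 : ℝ) < L := Nat.cast_pos.2 (Nat.pos_of_ne_zero (NeZero.ne L))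
  rw [overlapKernel_eq, norm_mul, Complex.norm_real, Real.norm_of_nonneg (by positivity)]
  congr 1
  fin_cases c
  · simp only [Fin.zero_eta, Fin.isValue, if_true]
    simp_rw [overlapPhase_zero]
    exact norm_sum_conj_hubbardPlaneWave_mul_eq hβ.ne' _ x y
  · simp only [Fin.mk_one, Fin.isValue, show (1 : Fin 2) ≠ 0 by decide, if_false]
    simp_rw [overlapPhase_one]
    exact norm_sum_conj_hubbardPlaneWave_mul_eq hβ.ne' _ y x

/-- Summing a function of the displacement `(x₀−y₀, x⃗−y⃗)` over the FIRST point is summing over the product torus. [folklore] -/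
theorem sum_spaceTime_eq_sum_prodTorus_fst {E : Type*} [AddCommMonoid E] (h : TorusSite 1 (2 * M) × TorusSite 2 L → E)
    (y : SpaceTimeIdx L M) :
    ∑ x : SpaceTimeIdx L M, h ((fun _ : Fin 1 => ((x.1 : ℕ) : ZMod (2 * M)) - ((y.1 : ℕ) : ZMod (2 * M))), x.2 - y.2) =
      ∑ q : TorusSite 1 (2 * M) × TorusSite 2 L, h q := by
  have h1 := sum_spaceTime_eq_sum_prodTorus (fun q => h (-q)) y
  have h2 : ∀ x : SpaceTimeIdx L M,
      (fun q => h (-q)) ((fun _ : Fin 1 => ((y.1 : ℕ) : ZMod (2 * M)) - ((x.1 : ℕ) : ZMod (2 * M))), y.2 - x.2) =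
        h ((fun _ : Fin 1 => ((x.1 : ℕ) : ZMod (2 * M)) - ((y.1 : ℕ) : ZMod (2 * M))), x.2 - y.2) := by
    intro x
    simp only [Prod.neg_mk, neg_sub]
    congr 2
    funext i
    simp
  simp_rw [h2] at h1
  rw [h1]
  exact Fintype.sum_equiv (Equiv.neg _) _ _ fun q => rfl

/-- **Row sum of the overlap kernel = `(βL²)⁻¹ ×` the `ℓ¹` norm of the character sum of the two-multiplier symbol**: for every
`ω′, ω, σ, c` and every row point `y`,
`Σ_x ‖(E′S)((y,(ω′,σ,c)),(x,(ω,σ,c)))‖ = (βL²)⁻¹ Σ_z ‖Σ_q χ_{q₁}(z₁)χ_{q₂}(z₂) • F′_{ω′}(k(q))F_ω(k(q))‖`.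
[cite: BenfattoGiulianiMastropietro2006, §2.7 (2.71a)] -/
theorem rowSum_overlapKernel_eq {β : ℝ} (hβ : 0 < β) (F' : Fin N' → FreqMomentum L M → ℂ) (F : Fin N → FreqMomentum L M → ℂ)
    (ω' : Fin N') (ω : Fin N) (σ c : Fin 2) (y : SpaceTimeIdx L M) :
    ∑ x : SpaceTimeIdx L M, ‖(sectorAnalysisMatrix L M β F' * sectorSubMatrix L M β F) (y, ((ω', σ), c)) (x, ((ω, σ), c))‖ =
      1 / (β * (L : ℝ) ^ 2) * ∑ z : TorusSite 1 (2 * M) × TorusSite 2 L,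
        ‖∑ q : TorusSite 1 (2 * M) × TorusSite 2 L, (torusChar q.1 z.1 * torusChar q.2 z.2) •
          (F' ω' (⟨(q.1 0).val, ZMod.val_lt (q.1 0)⟩, q.2) * F ω (⟨(q.1 0).val, ZMod.val_lt (q.1 0)⟩, q.2))‖ := by
  simp_rw [norm_overlapKernel_eq_charSum hβ]
  rw [← Finset.mul_sum]
  congr 1
  fin_cases c
  · simp only [Fin.zero_eta, Fin.isValue, if_true]
    exact sum_spaceTime_eq_sum_prodTorus_fst (fun z : TorusSite 1 (2 * M) × TorusSite 2 L =>
      ‖∑ q : TorusSite 1 (2 * M) × TorusSite 2 L, (torusChar q.1 z.1 * torusChar q.2 z.2) •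
        (F' ω' (⟨(q.1 0).val, ZMod.val_lt (q.1 0)⟩, q.2) * F ω (⟨(q.1 0).val, ZMod.val_lt (q.1 0)⟩, q.2))‖) y
  · simp only [Fin.mk_one, Fin.isValue, show (1 : Fin 2) ≠ 0 by decide, if_false]
    exact sum_spaceTime_eq_sum_prodTorus (fun z : TorusSite 1 (2 * M) × TorusSite 2 L =>
      ‖∑ q : TorusSite 1 (2 * M) × TorusSite 2 L, (torusChar q.1 z.1 * torusChar q.2 z.2) •
        (F' ω' (⟨(q.1 0).val, ZMod.val_lt (q.1 0)⟩, q.2) * F ω (⟨(q.1 0).val, ZMod.val_lt (q.1 0)⟩, q.2))‖) y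

/-- **Column sum of the overlap kernel** (sum over the row point `y` at fixed column point `x`) = the same quantity.
[cite: BenfattoGiulianiMastropietro2006, §2.7 (2.71a)] -/
theorem colSum_overlapKernel_eq {β : ℝ} (hβ : 0 < β) (F' : Fin N' → FreqMomentum L M → ℂ) (F : Fin N → FreqMomentum L M → ℂ)
    (ω' : Fin N') (ω : Fin N) (σ c : Fin 2) (x : SpaceTimeIdx L M) :
    ∑ y : SpaceTimeIdx L M, ‖(sectorAnalysisMatrix L M β F' * sectorSubMatrix L M β F) (y, ((ω', σ), c)) (x, ((ω, σ), c))‖ =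
      1 / (β * (L : ℝ) ^ 2) * ∑ z : TorusSite 1 (2 * M) × TorusSite 2 L,
        ‖∑ q : TorusSite 1 (2 * M) × TorusSite 2 L, (torusChar q.1 z.1 * torusChar q.2 z.2) •
          (F' ω' (⟨(q.1 0).val, ZMod.val_lt (q.1 0)⟩, q.2) * F ω (⟨(q.1 0).val, ZMod.val_lt (q.1 0)⟩, q.2))‖ := by
  simp_rw [norm_overlapKernel_eq_charSum hβ]
  rw [← Finset.mul_sum]
  congr 1
  fin_cases c
  · simp only [Fin.zero_eta, Fin.isValue, if_true]
    exact sum_spaceTime_eq_sum_prodTorus (fun z : TorusSite 1 (2 * M) × TorusSite 2 L =>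
      ‖∑ q : TorusSite 1 (2 * M) × TorusSite 2 L, (torusChar q.1 z.1 * torusChar q.2 z.2) •
        (F' ω' (⟨(q.1 0).val, ZMod.val_lt (q.1 0)⟩, q.2) * F ω (⟨(q.1 0).val, ZMod.val_lt (q.1 0)⟩, q.2))‖) x
  · simp only [Fin.mk_one, Fin.isValue, show (1 : Fin 2) ≠ 0 by decide, if_false]
    exact sum_spaceTime_eq_sum_prodTorus_fst (fun z : TorusSite 1 (2 * M) × TorusSite 2 L =>
      ‖∑ q : TorusSite 1 (2 * M) × TorusSite 2 L, (torusChar q.1 z.1 * torusChar q.2 z.2) •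
        (F' ω' (⟨(q.1 0).val, ZMod.val_lt (q.1 0)⟩, q.2) * F ω (⟨(q.1 0).val, ZMod.val_lt (q.1 0)⟩, q.2))‖) x

/-- **From an `ℓ¹` bound of the character sum to the one-kernel size `B`** consumed by
`rowSum_/colSum_sectorAnalysis_mul_sectorSub_le`: if `Σ_z ‖S_{ω′ω}(z)‖ ≤ T` for all sector pairs then both the `x`-sum and the `y`-sum
of the norms of one kernel are `≤ T/(βL²)`. [cite: BenfattoGiulianiMastropietro2006, §2.7 (2.71a)] -/
theorem overlapKernel_sums_le_of_charSum_le {β : ℝ} (hβ : 0 < β) (F' : Fin N' → FreqMomentum L M → ℂ)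
    (F : Fin N → FreqMomentum L M → ℂ) {T : ℝ}
    (hT : ∀ (ω' : Fin N') (ω : Fin N), ∑ z : TorusSite 1 (2 * M) × TorusSite 2 L,
      ‖∑ q : TorusSite 1 (2 * M) × TorusSite 2 L, (torusChar q.1 z.1 * torusChar q.2 z.2) •
        (F' ω' (⟨(q.1 0).val, ZMod.val_lt (q.1 0)⟩, q.2) * F ω (⟨(q.1 0).val, ZMod.val_lt (q.1 0)⟩, q.2))‖ ≤ T) :
    (∀ (ω' : Fin N') (ω : Fin N) (σ c : Fin 2) (y : SpaceTimeIdx L M),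
      ∑ x : SpaceTimeIdx L M, ‖(sectorAnalysisMatrix L M β F' * sectorSubMatrix L M β F) (y, ((ω', σ), c)) (x, ((ω, σ), c))‖ ≤
        T / (β * (L : ℝ) ^ 2)) ∧
    (∀ (ω' : Fin N') (ω : Fin N) (σ c : Fin 2) (x : SpaceTimeIdx L M),
      ∑ y : SpaceTimeIdx L M, ‖(sectorAnalysisMatrix L M β F' * sectorSubMatrix L M β F) (y, ((ω', σ), c)) (x, ((ω, σ), c))‖ ≤
        T / (β * (L : ℝ) ^ 2)) := by
  have hL : (0 : ℝ) < L := Nat.cast_pos.2 (Nat.pos_of_ne_zero (NeZero.ne L))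
  have hc : 0 ≤ 1 / (β * (L : ℝ) ^ 2) := by positivity
  refine ⟨fun ω' ω σ c y => ?_, fun ω' ω σ c x => ?_⟩
  · rw [rowSum_overlapKernel_eq hβ, div_eq_mul_one_div T (β * (L : ℝ) ^ 2), mul_comm T]
    exact mul_le_mul_of_nonneg_left (hT ω' ω) hc
  · rw [colSum_overlapKernel_eq hβ, div_eq_mul_one_div T (β * (L : ℝ) ^ 2), mul_comm T]
    exact mul_le_mul_of_nonneg_left (hT ω' ω) hc

end Summit.HubbardSuperconductivity.HubbardSuperconductivity.Theorems.TorusFourierL2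

end
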